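import Literature.NumberTheory.LFunctions.ConreyIwaniec2002HeckeVoronoiBounds
import Literature.Analysis.FunctionSpaces.ExpPolynomialWeightedApproximation
import HarnessLib

/-!
# Conrey–Iwaniec (2002), Proposition 3.1 at weight one (the Hecke–Voronoi summation formula): `HeckeVoronoiWeightOne`

B. Conrey, H. Iwaniec, *Spacing of zeros of Hecke L-functions and the class number problem*,
Acta Arith. 103 (2002) 259–312, §3 Proposition 3.1, (3.3)–(3.13) [held text
`paper:arxiv-math_0111012`, p0008].

**Proposition 3.1 (weight `k = 1`).** If `A(z) = a₀ + Σa(n)e(nz)`, `B(z) = b₀ + Σb(n)e(nz)`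
(divisor-bounded coefficients) satisfy the `ω`-relation (3.4)
`(iy)⁻¹A(x_A + i/(Cy)) = ηB(x_B + iy/C)` for all `y > 0` (`C = c√r`, `η ≠ 0`), then for every `g`
of class `C²` compactly supported in `(0,∞)`
`Σ_n a(n)e(nx_A)g(n) = (2πiη/C){b₀∫₀^∞g + Σ_n b(n)e(nx_B)∫₀^∞g(x)J₀((4π/C)√(nx))dx}` (3.11).
This file proves the tree's interface `ConreyIwaniec2002.HeckeVoronoiWeightOne`
(`ConreyIwaniec2002ThetaVoronoiDefs.lean`) — the registered stub V2 `stub_hecke_voronoi` of the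
sub-skeleton `theta-voronoi` (cell `landau-siegel/ls-inputs`) — as `hecke_voronoi`.

PROOF (the "Laplace route", replacing print's Mellin transform / functional equation (3.9) /
Mellin–Barnes integral (3.12)–(3.13)): (i) for `g(x) = e^{-px}` the relation (3.4) at
`y = 2π/(Cp)` is (3.11) term by term, by Weber's integral
`∫₀^∞e^{-px}J₀(β√x)dx = e^{-β²/(4p)}/p` (`ConreyIwaniec2002HeckeVoronoiExp.lean`,
`BesselJZeroSqrtLaplace.lean`); (ii) linearity gives all exponential polynomials
`Σq_ke^{-(k+2)x}`; (iii) a `C²` test function compactly supported in `(0,∞)` is approximated by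
exponential polynomials `f` with `|f-g|, |f'-g'|, |f''-g''| ≤ εe^{-2x}`
(`ExpPolynomialWeightedApproximation.lean`, Weierstrass); (iv) both sides of (3.11) are
continuous for this approximation (`ConreyIwaniec2002HeckeVoronoiBounds.lean`: the main side by
`|a(n)| ≤ Mτ(n)` and the weight `e^{-2n}`, the dual side by the Bessel decay
`|∫DJ₀(β√x)| ≪ β^{-5/2}∫x^{3/4}|D''|` (`BesselJSqrtKernelDecayExp.lean`) and `Στ(m)m^{-5/4} < ∞`);
the constant term `a₀f(0)` present for exponential polynomials disappears in the limit since
`g(0) = 0`.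

No definitions. «The programme SEARCHES and TYPES; no claim about Landau–Siegel zeros, Theorems
1–2 of arXiv:2211.02515 or a repaired Margin232 until a kernel theorem says so.» Nothing here
proves Propositions 3.2/3.3 (the transformation law of `θ(z;ψ)`, stub V1, is not touched).
-/

noncomputable section

open scoped Topology FourierTransform
open Filter Set MeasureTheory Complex

namespace Literature.NumberTheory.LFunctions

namespace ConreyIwaniec2002

open Literature.Analysis.FunctionSpaces

/-! ## Two elementary lemmas -/

/-- **The integral term**: if `‖D(x)‖ ≤ εe^{-2x}` on `[0,∞)` and `D` is continuous then `D` is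
integrable on `(0,∞)` with `‖∫₀^∞ D‖ ≤ ε/2`. [folklore] -/
private theorem integral_side_bound {ε : ℝ} {D : ℝ → ℂ} (hDc : Continuous D)
    (hD : ∀ x, 0 ≤ x → ‖D x‖ ≤ ε * Real.exp (-(2 * x))) :
    IntegrableOn D (Ioi 0) ∧ ‖∫ x in Ioi (0 : ℝ), D x‖ ≤ ε / 2 := by
  have hexp : IntegrableOn (fun x : ℝ => ε * Real.exp (-(2 * x))) (Ioi 0) := by
    have h := exp_neg_integrableOn_Ioi 0 (b := 2) two_pos
    have h2 : IntegrableOn (fun x : ℝ => Real.exp (-(2 * x))) (Ioi 0) := by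
      simpa only [neg_mul] using h
    exact h2.const_mul ε
  have hint : IntegrableOn D (Ioi 0) := by
    refine Integrable.mono' hexp hDc.aestronglyMeasurable ?_
    exact (ae_restrict_mem measurableSet_Ioi).mono fun x (hx : 0 < x) => hD x hx.le
  refine ⟨hint, ?_⟩
  have hval : ∫ x in Ioi (0 : ℝ), ε * Real.exp (-(2 * x)) = ε / 2 := by
    rw [integral_const_mul]
    have h := integral_exp_mul_Ioi (a := -2) (by norm_num) 0
    simp only [mul_zero, Real.exp_zero, neg_mul] at h
    rw [h]; ring
  calc ‖∫ x in Ioi (0 : ℝ), D x‖ ≤ ∫ x in Ioi (0 : ℝ), ‖D x‖ := norm_integral_le_integral_norm _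
    _ ≤ ∫ x in Ioi (0 : ℝ), ε * Real.exp (-(2 * x)) :=
        setIntegral_mono_on hint.norm hexp measurableSet_Ioi fun x (hx : 0 < x) => hD x hx.le
    _ = ε / 2 := hval

/-! ## A summation lemma -/

/-- If for every `ε > 0` the sequence `t` and the value `T` are within `O(ε)` of a convergent
series `Σ u = V` (`Σ‖u − t‖ ≤ c₁ε`, `‖V − T‖ ≤ c₂ε`), then `Σ t = T`. [folklore] -/
private theorem hasSum_of_approx {t : ℕ → ℂ} {T : ℂ} {c₁ c₂ : ℝ}
    (h : ∀ ε : ℝ, 0 < ε → ∃ (u : ℕ → ℂ) (V : ℂ), HasSum u V ∧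
      Summable (fun m => ‖u m - t m‖) ∧ (∑' m, ‖u m - t m‖) ≤ c₁ * ε ∧ ‖V - T‖ ≤ c₂ * ε) :
    HasSum t T := by
  obtain ⟨u₁, V₁, hu₁, hd₁, -, -⟩ := h 1 one_pos
  have ht : Summable t := by
    have := hu₁.summable.sub hd₁.of_norm
    exact this.congr fun m => by ring
  refine ht.hasSum_iff.mpr ?_
  have hbound : ∀ ε : ℝ, 0 < ε → ‖∑' m, t m - T‖ ≤ (c₁ + c₂) * ε := by
    intro ε hε
    obtain ⟨u, V, hu, hd, hc₁, hc₂⟩ := h ε hε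
    have h1 : ∑' m, t m - V = -∑' m, (u m - t m) := by
      rw [← hu.tsum_eq, Summable.tsum_sub hu.summable ht]
      ring
    calc ‖∑' m, t m - T‖ = ‖(∑' m, t m - V) + (V - T)‖ := by ring_nf
      _ ≤ ‖∑' m, t m - V‖ + ‖V - T‖ := norm_add_le _ _
      _ = ‖∑' m, (u m - t m)‖ + ‖V - T‖ := by rw [h1, norm_neg]
      _ ≤ (∑' m, ‖u m - t m‖) + ‖V - T‖ := by gcongr; exact norm_tsum_le_tsum_norm hd
      _ ≤ c₁ * ε + c₂ * ε := add_le_add hc₁ hc₂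
      _ = (c₁ + c₂) * ε := by ring
  have hzero : ‖∑' m, t m - T‖ ≤ 0 := by
    rcases le_or_gt (c₁ + c₂) 0 with hneg | hpos
    · have := hbound 1 one_pos
      nlinarith
    · refine le_of_forall_pos_le_add fun δ hδ => ?_
      have := hbound (δ / (c₁ + c₂)) (by positivity)
      rw [mul_div_cancel₀ _ hpos.ne'] at this
      linarith
  have : ∑' m, t m - T = 0 := norm_le_zero_iff.mp hzero
  exact sub_eq_zero.mp this


/-! ## Facts about the test function and the kernel -/

/-- A `C²` function is differentiable with derivative `g'`. [folklore] -/
private theorem hasDerivAt_of_contDiff_two {g : ℝ → ℂ} (hg : ContDiff ℝ 2 g) (x : ℝ) :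
    HasDerivAt g (deriv g x) x :=
  ((hg.differentiable (by norm_num)) x).hasDerivAt

/-- For a `C²` function, `g'` has derivative `g'' = iteratedDeriv 2 g`. [folklore] -/
private theorem hasDerivAt_deriv_of_contDiff_two {g : ℝ → ℂ} (hg : ContDiff ℝ 2 g) (x : ℝ) :
    HasDerivAt (deriv g) (iteratedDeriv 2 g x) x := by
  have h1 : ContDiff ℝ 1 (deriv g) := by
    have := hg.iterate_deriv' 1 1
    simpa using this
  have h2 : HasDerivAt (deriv g) (deriv (deriv g) x) x :=
    ((h1.differentiable (by norm_num)) x).hasDerivAt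
  rwa [iteratedDeriv_succ, iteratedDeriv_one]

/-- The kernel `x ↦ J₀((4π/c)√(mx/r))` is continuous. [folklore] -/
private theorem continuous_ciBesselKernel_const (r c m : ℕ) :
    Continuous (fun x : ℝ => ciBesselKernel (fun _ ↦ r) c m x) := by
  simp_rw [ciBesselKernel_const_eq]
  exact Complex.continuous_ofReal.comp (continuous_besselJ_zero_sqrt _)

/-- `‖J₀((4π/c)√(mx/r))‖ ≤ 1`. [folklore] -/
private theorem norm_ciBesselKernel_const_le (r c m : ℕ) (x : ℝ) :
    ‖ciBesselKernel (fun _ ↦ r) c m x‖ ≤ 1 := by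
  rw [ciBesselKernel_const_eq, Complex.norm_real, Real.norm_eq_abs]
  exact abs_besselJ_zero_sqrt_le_one _ _

/-! ## The theorem -/

/-- **Conrey–Iwaniec (2002), Proposition 3.1 at weight one** — the tree's interface
`HeckeVoronoiWeightOne` (registered stub V2 `stub_hecke_voronoi` of the sub-skeleton
`theta-voronoi`): the `ω`-relation (3.4) with `η ≠ 0`, `C = c√r` and divisor-bounded coefficients
implies the summation formula (3.11) for every `C²` test function compactly supported in
`(0,∞)`, the dual series being absolutely convergent (`HasSum`). Proof by the Laplace route
(module docstring). [cite: ConreyIwaniec2002, Proposition 3.1 (3.11)] -/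
theorem hecke_voronoi : HeckeVoronoiWeightOne := by
  intro c r hc hr η hη M lamA lamB hA hB a₀ b₀ xA xB hrel g hg hsuppex
  obtain ⟨X₁, X₂, hX₁, hsupp⟩ := hsuppex
  obtain ⟨C₁, hC₁⟩ := dual_side_bound hc hr hB
  obtain ⟨C₂, hC₂⟩ := main_side_bound hA xA
  set κ : ℂ := 2 * Real.pi * I * η / ((c : ℝ) * Real.sqrt r) with hκ
  -- facts about `g`
  have hg0 : g 0 = 0 := hsupp 0 fun h => by linarith [h.1]
  have hgc : Continuous g := hg.continuous
  have hgcs : HasCompactSupport g := HasCompactSupport.intro isCompact_Icc hsupp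
  have hgX : ∀ x : ℝ, X₂ < x → g x = 0 := fun x hx => hsupp x fun h => absurd h.2 (not_le.mpr hx)
  have hg' := hasDerivAt_of_contDiff_two hg
  have hg'' := hasDerivAt_deriv_of_contDiff_two hg
  have hg''c : Continuous (iteratedDeriv 2 g) := hg.continuous_iteratedDeriv 2 le_rfl
  have hgint : IntegrableOn g (Ioi 0) := (hgc.integrable_of_hasCompactSupport hgcs).integrableOn
  have hgKint : ∀ m : ℕ, IntegrableOn (fun x : ℝ => g x * ciBesselKernel (fun _ ↦ r) c (m + 1) x)
      (Ioi 0) := fun m =>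
    ((hgc.mul (continuous_ciBesselKernel_const r c (m + 1))).integrable_of_hasCompactSupport
      hgcs.mul_right).integrableOn
  -- the shifted `a`-side of `g` is finitely supported
  have hAfin : ∀ n : ℕ, n ∉ Finset.range (⌈X₂⌉₊ + 1) →
      lamA (n + 1) * ((𝐞 (((n : ℝ) + 1) * xA) : Circle) : ℂ) * g ((n : ℝ) + 1) = 0 := by
    intro n hn
    rw [Finset.mem_range, not_lt] at hn
    have h1 : (X₂ : ℝ) < (n : ℝ) + 1 := by
      have := Nat.le_ceil X₂
      have h2 : ((⌈X₂⌉₊ + 1 : ℕ) : ℝ) ≤ n := by exact_mod_cast hn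
      push_cast at h2
      linarith
    rw [hgX _ h1, mul_zero]
  have hAsum : Summable (fun n : ℕ => lamA (n + 1) * ((𝐞 (((n : ℝ) + 1) * xA) : Circle) : ℂ) *
      g ((n : ℝ) + 1)) := summable_of_ne_finset_zero hAfin
  -- the summation formula in shifted form
  have key : HasSum
      (fun m : ℕ ↦ κ * lamB (m + 1) * ((𝐞 (((m : ℝ) + 1) * xB) : Circle) : ℂ) *
        ∫ x in Ioi (0 : ℝ), g x * ciBesselKernel (fun _ ↦ r) c (m + 1) x)
      ((∑' n : ℕ, lamA (n + 1) * ((𝐞 (((n : ℝ) + 1) * xA) : Circle) : ℂ) * g ((n : ℝ) + 1)) -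
        κ * b₀ * ∫ x in Ioi (0 : ℝ), g x) := by
    refine hasSum_of_approx (c₁ := ‖κ‖ * C₁) (c₂ := ‖a₀‖ + C₂ + ‖κ‖ * ‖b₀‖ / 2) fun ε hε => ?_
    obtain ⟨N, q, hF, hF₁, hF₂c, hbd⟩ := exists_expPoly_approx hg hsupp hε
    -- the exponential polynomial `F` and its derivatives
    set w : ℕ → ℂ := fun k => q k / ((k : ℂ) + 2) ^ 2 with hw
    set F : ℝ → ℂ := fun x => ∑ k ∈ Finset.range N,
      w k * ((Real.exp (-(((k : ℝ) + 2) * x)) : ℝ) : ℂ) with hFdef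
    set F₁ : ℝ → ℂ := fun x => -∑ k ∈ Finset.range N,
      q k * ((Real.exp (-(((k : ℝ) + 2) * x)) : ℝ) : ℂ) / ((k : ℂ) + 2) with hF₁def
    set F₂ : ℝ → ℂ := fun x => ∑ k ∈ Finset.range N,
      q k * ((Real.exp (-(((k : ℝ) + 2) * x)) : ℝ) : ℂ) with hF₂def
    have hFpt : ∀ x : ℝ, (∑ k ∈ Finset.range N,
        q k * ((Real.exp (-(((k : ℝ) + 2) * x)) : ℝ) : ℂ) / ((k : ℂ) + 2) ^ 2) = F x := by
      intro x
      simp only [hFdef, hw]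
      exact Finset.sum_congr rfl fun k _ => by ring
    have hFeq : (fun x : ℝ => ∑ k ∈ Finset.range N,
        q k * ((Real.exp (-(((k : ℝ) + 2) * x)) : ℝ) : ℂ) / ((k : ℂ) + 2) ^ 2) = F := funext hFpt
    rw [hFeq] at hF
    have hbd' : ∀ x : ℝ, 0 ≤ x → ‖F x - g x‖ ≤ ε * Real.exp (-(2 * x)) ∧
        ‖F₁ x - deriv g x‖ ≤ ε * Real.exp (-(2 * x)) ∧
        ‖F₂ x - iteratedDeriv 2 g x‖ ≤ ε * Real.exp (-(2 * x)) := by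
      intro x hx
      have := hbd x hx
      rw [hFpt x] at this
      exact this
    -- the difference `D = F - g`
    have hD : ∀ x, HasDerivAt (fun x => F x - g x) (F₁ x - deriv g x) x :=
      fun x => (hF x).sub (hg' x)
    have hD₁ : ∀ x, HasDerivAt (fun x => F₁ x - deriv g x) (F₂ x - iteratedDeriv 2 g x) x :=
      fun x => (hF₁ x).sub (hg'' x)
    have hD₂c : Continuous (fun x => F₂ x - iteratedDeriv 2 g x) := hF₂c.sub hg''c
    have hFc : Continuous F := continuous_iff_continuousAt.mpr fun x => (hF x).continuousAt
    have hDc : Continuous (fun x => F x - g x) := hFc.sub hgc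
    have hbd0 : ∀ x : ℝ, 0 ≤ x → ‖F x - g x‖ ≤ ε * Real.exp (-(2 * x)) := fun x hx => (hbd' x hx).1
    have hDint := integral_side_bound (ε := ε) hDc hbd0
    have hFint : IntegrableOn F (Ioi 0) :=
      (hDint.1.add hgint).congr (Filter.Eventually.of_forall fun x => by simp)
    have hDual := hC₁ ε _ _ _ hD hD₁ hD₂c hbd'
    have hMain := hC₂ ε (fun x => F x - g x) hbd0
    -- (ii): the formula for `F`
    have hV : HasSum
        (fun m : ℕ ↦ κ * lamB (m + 1) * ((𝐞 (((m : ℝ) + 1) * xB) : Circle) : ℂ) *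
          ∫ x in Ioi (0 : ℝ), F x * ciBesselKernel (fun _ ↦ r) c (m + 1) x)
        (a₀ * F 0 +
          (∑' n : ℕ, lamA (n + 1) * ((𝐞 (((n : ℝ) + 1) * xA) : Circle) : ℂ) * F ((n : ℝ) + 1)) -
          κ * b₀ * ∫ x in Ioi (0 : ℝ), F x) :=
      voronoi_hasSum_expPoly hc hr hA hB hrel (Finset.range N) w (fun k => (k : ℝ) + 2)
        (fun k _ => by positivity)
    -- the term differences
    have hDKint : ∀ m : ℕ, IntegrableOn
        (fun x : ℝ => (F x - g x) * ciBesselKernel (fun _ ↦ r) c (m + 1) x) (Ioi 0) := by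
      intro m
      refine (integral_side_bound (ε := ε) (hDc.mul (continuous_ciBesselKernel_const r c (m + 1)))
        fun x hx => ?_).1
      show ‖(F x - g x) * ciBesselKernel (fun _ ↦ r) c (m + 1) x‖ ≤ ε * Real.exp (-(2 * x))
      rw [norm_mul]
      calc ‖F x - g x‖ * ‖ciBesselKernel (fun _ ↦ r) c (m + 1) x‖ ≤ ε * Real.exp (-(2 * x)) * 1 :=
            mul_le_mul (hbd0 x hx) (norm_ciBesselKernel_const_le r c (m + 1) x) (norm_nonneg _)
              (by positivity)
        _ = ε * Real.exp (-(2 * x)) := mul_one _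
    have hdiff : ∀ m : ℕ,
        κ * lamB (m + 1) * ((𝐞 (((m : ℝ) + 1) * xB) : Circle) : ℂ) *
            (∫ x in Ioi (0 : ℝ), F x * ciBesselKernel (fun _ ↦ r) c (m + 1) x) -
          κ * lamB (m + 1) * ((𝐞 (((m : ℝ) + 1) * xB) : Circle) : ℂ) *
            (∫ x in Ioi (0 : ℝ), g x * ciBesselKernel (fun _ ↦ r) c (m + 1) x) =
          κ * lamB (m + 1) * ((𝐞 (((m : ℝ) + 1) * xB) : Circle) : ℂ) *
            ∫ x in Ioi (0 : ℝ), (F x - g x) * ciBesselKernel (fun _ ↦ r) c (m + 1) x := by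
      intro m
      have hFK : IntegrableOn (fun x : ℝ => F x * ciBesselKernel (fun _ ↦ r) c (m + 1) x) (Ioi 0) :=
        ((hDKint m).add (hgKint m)).congr (Filter.Eventually.of_forall fun x => by
          simp only [Pi.add_apply]; ring)
      rw [← mul_sub, ← integral_sub hFK (hgKint m)]
      congr 1
      refine integral_congr_ae (Filter.Eventually.of_forall fun x => ?_)
      ring
    have hnorm : ∀ m : ℕ,
        ‖κ * lamB (m + 1) * ((𝐞 (((m : ℝ) + 1) * xB) : Circle) : ℂ) *
            (∫ x in Ioi (0 : ℝ), F x * ciBesselKernel (fun _ ↦ r) c (m + 1) x) -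
          κ * lamB (m + 1) * ((𝐞 (((m : ℝ) + 1) * xB) : Circle) : ℂ) *
            (∫ x in Ioi (0 : ℝ), g x * ciBesselKernel (fun _ ↦ r) c (m + 1) x)‖ =
          ‖κ‖ * (‖lamB (m + 1)‖ *
            ‖∫ x in Ioi (0 : ℝ), (F x - g x) * ciBesselKernel (fun _ ↦ r) c (m + 1) x‖) := by
      intro m
      rw [hdiff m, norm_mul, norm_mul, norm_mul, Circle.norm_coe, mul_one, mul_assoc]
    refine ⟨_, _, hV, ?_, ?_, ?_⟩
    · exact (hDual.1.mul_left ‖κ‖).congr fun m => (hnorm m).symm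
    · rw [tsum_congr hnorm, tsum_mul_left, mul_assoc]
      exact mul_le_mul_of_nonneg_left hDual.2 (norm_nonneg κ)
    · -- the values
      have hSF : Summable (fun n : ℕ => lamA (n + 1) * ((𝐞 (((n : ℝ) + 1) * xA) : Circle) : ℂ) *
          F ((n : ℝ) + 1)) :=
        (hMain.1.add hAsum).congr fun n => by ring
      have hS : (∑' n : ℕ, lamA (n + 1) * ((𝐞 (((n : ℝ) + 1) * xA) : Circle) : ℂ) * F ((n : ℝ) + 1)) -
          (∑' n : ℕ, lamA (n + 1) * ((𝐞 (((n : ℝ) + 1) * xA) : Circle) : ℂ) * g ((n : ℝ) + 1)) =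
          ∑' n : ℕ, lamA (n + 1) * ((𝐞 (((n : ℝ) + 1) * xA) : Circle) : ℂ) *
            (F ((n : ℝ) + 1) - g ((n : ℝ) + 1)) := by
        rw [← Summable.tsum_sub hSF hAsum]
        exact tsum_congr fun n => by ring
      have hI : (∫ x in Ioi (0 : ℝ), F x) - (∫ x in Ioi (0 : ℝ), g x) =
          ∫ x in Ioi (0 : ℝ), (F x - g x) := (integral_sub hFint hgint).symm
      have hF0 : ‖F 0‖ ≤ ε := by
        have := hbd0 0 le_rfl
        rw [hg0, sub_zero, mul_zero, neg_zero, Real.exp_zero, mul_one] at this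
        exact this
      have hκb : ‖κ * b₀ * ∫ x in Ioi (0 : ℝ), (F x - g x)‖ ≤ ‖κ‖ * ‖b₀‖ * (ε / 2) := by
        rw [norm_mul, norm_mul]
        exact mul_le_mul_of_nonneg_left hDint.2 (by positivity)
      calc ‖a₀ * F 0 +
            (∑' n : ℕ, lamA (n + 1) * ((𝐞 (((n : ℝ) + 1) * xA) : Circle) : ℂ) * F ((n : ℝ) + 1)) -
            κ * b₀ * (∫ x in Ioi (0 : ℝ), F x) -
            ((∑' n : ℕ, lamA (n + 1) * ((𝐞 (((n : ℝ) + 1) * xA) : Circle) : ℂ) * g ((n : ℝ) + 1)) -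
              κ * b₀ * ∫ x in Ioi (0 : ℝ), g x)‖
          = ‖a₀ * F 0 +
              (∑' n : ℕ, lamA (n + 1) * ((𝐞 (((n : ℝ) + 1) * xA) : Circle) : ℂ) *
                (F ((n : ℝ) + 1) - g ((n : ℝ) + 1))) -
              κ * b₀ * ∫ x in Ioi (0 : ℝ), (F x - g x)‖ := by
            rw [← hS, ← hI]
            congr 1
            ring
        _ ≤ ‖a₀ * F 0‖ +
              ‖∑' n : ℕ, lamA (n + 1) * ((𝐞 (((n : ℝ) + 1) * xA) : Circle) : ℂ) *
                (F ((n : ℝ) + 1) - g ((n : ℝ) + 1))‖ +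
              ‖κ * b₀ * ∫ x in Ioi (0 : ℝ), (F x - g x)‖ :=
            (norm_sub_le _ _).trans (add_le_add (norm_add_le _ _) le_rfl)
        _ ≤ ‖a₀‖ * ε + C₂ * ε + ‖κ‖ * ‖b₀‖ * (ε / 2) := by
            refine add_le_add (add_le_add ?_ hMain.2) hκb
            rw [norm_mul]
            exact mul_le_mul_of_nonneg_left hF0 (norm_nonneg _)
        _ = (‖a₀‖ + C₂ + ‖κ‖ * ‖b₀‖ / 2) * ε := by ring
  -- back to the unshifted `a`-side
  have hAfin0 : ∀ n : ℕ, n ∉ Finset.range (⌈X₂⌉₊ + 1) →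
      lamA n * ((𝐞 ((n : ℝ) * xA) : Circle) : ℂ) * g n = 0 := by
    intro n hn
    rw [Finset.mem_range, not_lt] at hn
    have h1 : (X₂ : ℝ) < (n : ℝ) := by
      have := Nat.le_ceil X₂
      have h2 : ((⌈X₂⌉₊ + 1 : ℕ) : ℝ) ≤ n := by exact_mod_cast hn
      push_cast at h2
      linarith
    rw [hgX _ h1, mul_zero]
  have hAsum0 : Summable (fun n : ℕ => lamA n * ((𝐞 ((n : ℝ) * xA) : Circle) : ℂ) * g n) :=
    summable_of_ne_finset_zero hAfin0
  have hshift : (∑' n : ℕ, lamA n * ((𝐞 ((n : ℝ) * xA) : Circle) : ℂ) * g n) =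
      ∑' n : ℕ, lamA (n + 1) * ((𝐞 (((n : ℝ) + 1) * xA) : Circle) : ℂ) * g ((n : ℝ) + 1) := by
    rw [hAsum0.tsum_eq_zero_add]
    push_cast
    rw [hg0, mul_zero, zero_add]
  rw [hshift]
  exact key

end ConreyIwaniec2002

end Literature.NumberTheory.LFunctions

end
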